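import Summits.ABC.StewartYu.PadicG3SchedB
import Summits.ABC.StewartYu.PadicG3ParE
import Literature.NumberTheory.Transcendental.PadicCW77Assembly
import HarnessLib

/-!
# Cell abc-stewartyu, crux `Y07Odd` (stmt-ABC-19658), line `gen3-slab-odd`, branch `m ≥ 1`: the EXPONENT LINES of the four step families at the
# v1 schedule `P.sched1b b` — every family's smallness exponent `⌊(t−1)/2⌋ + condExp + m·g + ⌈g/2⌉` is `≤ E` as soon as `11·2ⁿ·(G·X·L) ≤ E·log p`

`Summits/ABC/StewartYu/PadicG3OneExpLines.lean` — cell `abc-stewartyu` (HOME `run/shared/lean/pub/abc-stewartyu/`), seat p5 (g4); Part B of the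
`stub_ineqs1` glue (the `hexp*` inputs of `G3Setup.ineqPackR₃_of_lines`, `PadicG3OddLines`).  Theorems only (real arithmetic on p1's v1 ledger
`PadicG3Par`: `Xs s·(T s+1) ≤ 4XL`, `T s ≤ 8L`, `(T s+1)·log(2(2^{ν+1}Xs s+1)) ≤ Z/4` (`Acond_tlog_le`), `X ≥ 72`, `G ≥ 16`, `log p ≤ p − 1`,
`G = (m+½)·log p ≥ (3/2)·log p` at `θ₀ = ½`, `m ≥ 1`); no named fact.

* `famExp_le_of_real` — the natural exponent line from its real form (`condExp·log p ≤ kpts·t·log p/(p−1) + t·log(2 kpts)`, `condExp_mul_log_le`);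
* `expCore_sched1` — `(t/2+1)·log p + kpts·t·log p/(p−1) + t·log(2 kpts) + kpts·t·(m+½)·log p ≤ 11·2ⁿ·(G·X·L)` for `t = T s + 1`, `kpts ≤ 2^{ν+1}·Xs s + 1`, `ν ≤ n`;
* **`hexpK0_sched1b`**, **`hexpH_sched1b`**, **`hexpO_sched1b`**, **`hexpK_sched1b`** — the four `hexp*` hypotheses of `ineqPackR₃_of_lines` at
  `Sc := P.sched1b b` from `(hE : 11·2ⁿ·(G·X·L) ≤ E·log p)` (any `b`; the headline gives `16·2ⁿ·(G·X·L) − W`).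

WHAT THIS IS NOT: the gain lines (Part A: p1 g8 k-steps, p4 g4 half-step); the exponent `E` itself (p2's `PadicG3ExpLine` + lp-1's `headline_odd1`).

References: Yu. V. Nesterenko, LNM 1819 (2003) §4.2 (4.29)–(4.30); K. Yu, Compositio 74 (1990) §3 (conditioning of the interpolation).
-/

noncomputable section

open Finset Real
open Literature.NumberTheory.Transcendental
open Literature.NumberTheory.Transcendental.PadicCW77 (condExp)

namespace Summit.ABC.StewartYu

namespace PadicG3Par

variable {n : ℕ} (P : PadicG3Par n)

/-! ### The natural exponent line from its real form -/

omit P in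
/-- **`⌊(t−1)/2⌋ + condExp p kpts t + m·(kpts·t) + ⌈(kpts·t)/2⌉ ≤ E`** from
`(t/2 + 1)·log p + (kpts·t·log p/(p−1) + t·log(2·kpts)) + (kpts·t)·(m+½)·log p ≤ E·log p`. [cite: Yu1990, §3; shape only] -/
theorem famExp_le_of_real {p : ℕ} (hp : 2 ≤ p) {t kpts m E : ℕ}
    (h : ((t : ℝ) / 2 + 1) * Real.log p + ((kpts : ℝ) * t * (Real.log p / ((p : ℝ) - 1)) + t * Real.log (2 * kpts)) +
      ((kpts * t : ℕ) : ℝ) * (((m : ℝ) + 1 / 2) * Real.log p) ≤ (E : ℝ) * Real.log p) :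
    (t - 1) / 2 + condExp p kpts t + m * (kpts * t) + (kpts * t + 1) / 2 ≤ E := by
  have hp1 : (1 : ℝ) < p := by exact_mod_cast (show 1 < p by omega)
  have hlogp : 0 < Real.log p := Real.log_pos hp1
  have hc := PadicCW77.condExp_mul_log_le hp kpts t
  -- real forms of the natural divisions
  have h1 : (((t - 1) / 2 : ℕ) : ℝ) ≤ (t : ℝ) / 2 := by
    calc (((t - 1) / 2 : ℕ) : ℝ) ≤ ((t - 1 : ℕ) : ℝ) / 2 := Nat.cast_div_le
      _ ≤ (t : ℝ) / 2 := by gcongr; exact_mod_cast Nat.sub_le t 1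
  have h2 : (((kpts * t + 1) / 2 : ℕ) : ℝ) ≤ ((kpts * t : ℕ) : ℝ) / 2 + 1 / 2 := by
    calc (((kpts * t + 1) / 2 : ℕ) : ℝ) ≤ ((kpts * t + 1 : ℕ) : ℝ) / 2 := Nat.cast_div_le
      _ = ((kpts * t : ℕ) : ℝ) / 2 + 1 / 2 := by push_cast; ring
  -- multiply the claimed natural inequality by `log p`
  have key : (((t - 1) / 2 + condExp p kpts t + m * (kpts * t) + (kpts * t + 1) / 2 : ℕ) : ℝ) * Real.log p ≤ (E : ℝ) * Real.log p := by
    push_cast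
    have e1 : (((t - 1) / 2 : ℕ) : ℝ) * Real.log p ≤ (t : ℝ) / 2 * Real.log p := mul_le_mul_of_nonneg_right h1 hlogp.le
    have e2 : (((kpts * t + 1) / 2 : ℕ) : ℝ) * Real.log p ≤ (((kpts * t : ℕ) : ℝ) / 2 + 1 / 2) * Real.log p :=
      mul_le_mul_of_nonneg_right h2 hlogp.le
    have e3 : ((m : ℝ) * ((kpts * t : ℕ) : ℝ)) * Real.log p + (((kpts * t : ℕ) : ℝ) / 2) * Real.log p =
        ((kpts * t : ℕ) : ℝ) * (((m : ℝ) + 1 / 2) * Real.log p) := by ring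
    push_cast at e2 e3 hc h ⊢
    nlinarith
  have := le_of_mul_le_mul_right key hlogp
  exact_mod_cast this

/-! ### The core real inequality at the v1 schedule -/

/-- `log p ≤ G` and `(3/2)·log p ≤ G` at `m ≥ 1`, `θ₀ = ½`. [folklore] -/
theorem log_p_le_G_of_m_pos (hm : 1 ≤ P.m) (hθ : P.θ₀ = 1 / 2) : (3 / 2) * Real.log P.p ≤ P.G := by
  unfold G θm
  rw [hθ]
  have hm' : (1 : ℝ) ≤ P.m := by exact_mod_cast hm
  have hl := P.log_p_pos
  nlinarith

/-- `W ≤ Z/64` (`W + log 2L + 1 ≤ W_L`, `(n+1)·L·W_L ≤ G X L/64`, `L ≥ 1`). [folklore] -/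
theorem W_le_Z : P.W ≤ P.G * P.X * P.L / 64 := by
  have h1 := P.W_add_log_le_WL
  have h2 := P.WL_mul_le
  have hL := P.one_le_L
  have hlog : 0 ≤ Real.log (2 * P.L) := Real.log_nonneg (by linarith)
  have hWL : P.W ≤ P.WL := by linarith
  have hWL0 : 0 ≤ P.WL := by linarith [P.WL_ge_one]
  have hn : (0 : ℝ) ≤ n := Nat.cast_nonneg n
  have hnL : (1 : ℝ) ≤ (n + 1) * P.L := by nlinarith
  have h3 : P.WL ≤ (n + 1) * P.L * P.WL := by
    have := mul_le_mul_of_nonneg_right hnL hWL0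
    linarith
  linarith

/-- **The core line**: for `t = T s + 1`, `1 ≤ kpts ≤ 2^{ν+1}·Xs s + 1`, `ν ≤ n`, `m ≥ 1`, `θ₀ = ½`:
`(t/2+1)·log p + kpts·t·log p/(p−1) + t·log(2·kpts) + kpts·t·(m+½)·log p ≤ 11·2ⁿ·(G·X·L)`. [cite: Nesterenko2003, §4.2 (4.29)–(4.30); shape only] -/
theorem expCore_sched1 (hm : 1 ≤ P.m) (hθ : P.θ₀ = 1 / 2) (s : ℕ) {ν : ℕ} (hν : ν ≤ n) {kpts : ℕ} (hk1 : 1 ≤ kpts)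
    (hk : (kpts : ℝ) ≤ 2 ^ (ν + 1) * (P.Xs s : ℝ) + 1) :
    ((((P.T s + 1 : ℕ) : ℝ)) / 2 + 1) * Real.log P.p +
      ((kpts : ℝ) * ((P.T s + 1 : ℕ) : ℝ) * (Real.log P.p / ((P.p : ℝ) - 1)) + ((P.T s + 1 : ℕ) : ℝ) * Real.log (2 * kpts)) +
      ((kpts * (P.T s + 1) : ℕ) : ℝ) * (((P.m : ℝ) + 1 / 2) * Real.log P.p) ≤ 11 * 2 ^ n * (P.G * P.X * P.L) := by
  -- the ledger facts
  have hXs := P.Xs_mul_le s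
  have hT : (P.T s : ℝ) ≤ 8 * P.L := by exact_mod_cast P.T_le s
  have hX := P.seventytwo_le_X
  have hL := P.one_le_L
  have hL25 := P.two_pow_25_le_L
  have hG16 := P.sixteen_le_G
  have hlp := P.log_p_pos
  have hp2 := P.two_le_p
  have hGlog := P.log_p_le_G_of_m_pos hm hθ
  have hAc := P.Acond_tlog_le s hν
  have hGdef : ((P.m : ℝ) + 1 / 2) * Real.log P.p = P.G := by unfold G θm; rw [hθ]
  set Z : ℝ := P.G * P.X * P.L with hZ
  have hG0 : (0 : ℝ) ≤ P.G := by linarith only [hG16]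
  have hX0 : (0 : ℝ) ≤ P.X := by linarith only [hX]
  have hL0 : (0 : ℝ) ≤ (P.L : ℝ) := by linarith only [hL]
  have hXL0 : (0 : ℝ) ≤ P.X * P.L := mul_nonneg hX0 hL0
  have hGL0 : (0 : ℝ) ≤ P.G * P.L := mul_nonneg hG0 hL0
  have h2νn : (2 : ℝ) ^ ν ≤ 2 ^ n := pow_le_pow_right₀ (by norm_num) hν
  have h2n1 : (1 : ℝ) ≤ 2 ^ n := one_le_pow₀ (by norm_num)
  have h2n0 : (0 : ℝ) ≤ 2 ^ n := zero_le_one.trans h2n1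
  -- unit comparisons: GL ≤ Z/72, XL ≤ Z/16, L ≤ Z/1152, G ≤ Z/1152, Z ≤ 2ⁿZ
  have hGL : P.G * P.L ≤ Z / 72 := by
    rw [hZ, le_div_iff₀ (by norm_num)]
    have h := mul_le_mul_of_nonneg_left hX hGL0
    have e : P.G * P.L * (P.X : ℝ) = P.G * P.X * P.L := by ring
    linarith only [h, e]
  have hXL : P.X * P.L ≤ Z / 16 := by
    rw [hZ, le_div_iff₀ (by norm_num)]
    have h := mul_le_mul_of_nonneg_left hG16 hXL0
    have e : (P.X : ℝ) * P.L * P.G = P.G * P.X * P.L := by ring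
    linarith only [h, e]
  have hLZ : (P.L : ℝ) ≤ Z / 1152 := by rw [hZ]; exact P.L_le_GXL
  have hGZ : P.G ≤ Z / 1152 := by
    rw [hZ, le_div_iff₀ (by norm_num)]
    have h1 : (72 : ℝ) * 2 ^ 25 ≤ P.X * P.L := mul_le_mul hX hL25 (by norm_num) hX0
    have h2 : (1152 : ℝ) ≤ P.X * P.L := by
      have : (72 : ℝ) * 2 ^ 25 = 2415919104 := by norm_num
      linarith only [h1, this]
    have h3 := mul_le_mul_of_nonneg_left h2 hG0
    have e : P.G * ((P.X : ℝ) * P.L) = P.G * P.X * P.L := by ring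
    linarith only [h3, e]
  have hZ0 : 0 ≤ Z := by rw [hZ]; exact mul_nonneg (mul_nonneg hG0 hX0) hL0
  have hZ2 : Z ≤ 2 ^ n * Z := le_mul_of_one_le_left hZ0 h2n1
  -- (a) kpts·t ≤ 8·2ⁿ·XL + 9L
  have hXs0 : (0 : ℝ) ≤ P.Xs s := Nat.cast_nonneg _
  have hT0 : (0 : ℝ) ≤ (P.T s : ℝ) + 1 := by
    have : (0 : ℝ) ≤ (P.T s : ℝ) := Nat.cast_nonneg _
    linarith only [this]
  have hk0' : (0 : ℝ) ≤ (kpts : ℝ) := Nat.cast_nonneg _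
  have hkt : (kpts : ℝ) * ((P.T s : ℝ) + 1) ≤ 8 * 2 ^ n * (P.X * P.L) + 9 * P.L := by
    have e1 : (kpts : ℝ) * ((P.T s : ℝ) + 1) ≤ (2 ^ (ν + 1) * (P.Xs s : ℝ) + 1) * ((P.T s : ℝ) + 1) :=
      mul_le_mul_of_nonneg_right hk hT0
    have e2 : (2 ^ (ν + 1) * (P.Xs s : ℝ) + 1) * ((P.T s : ℝ) + 1) = 2 ^ ν * (2 * ((P.Xs s : ℝ) * (P.T s + 1))) + (P.T s + 1) := by
      rw [pow_succ]; ring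
    have hXs8 : 2 * ((P.Xs s : ℝ) * (P.T s + 1)) ≤ 2 * (4 * P.X * P.L) := by linarith only [hXs]
    have h2x0 : (0 : ℝ) ≤ 2 * ((P.Xs s : ℝ) * (P.T s + 1)) := by
      have := mul_nonneg hXs0 hT0; linarith only [this]
    have e3 : (2 : ℝ) ^ ν * (2 * ((P.Xs s : ℝ) * (P.T s + 1))) ≤ 2 ^ n * (2 * (4 * P.X * P.L)) :=
      mul_le_mul h2νn hXs8 h2x0 h2n0
    rw [e2] at e1
    have e4 : (2 : ℝ) ^ n * (2 * (4 * P.X * P.L)) = 8 * 2 ^ n * (P.X * P.L) := by ring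
    linarith only [e1, e3, e4, hT, hL]
  have hkt0 : (0 : ℝ) ≤ (kpts : ℝ) * ((P.T s : ℝ) + 1) := mul_nonneg hk0' hT0
  -- (a') kpts·t·G ≤ 8·2ⁿ·Z + Z/8
  have hA : (kpts : ℝ) * ((P.T s : ℝ) + 1) * P.G ≤ 8 * 2 ^ n * Z + Z / 8 := by
    have h := mul_le_mul_of_nonneg_right hkt hG0
    have e : (8 * 2 ^ n * (P.X * P.L) + 9 * P.L) * P.G = 8 * 2 ^ n * Z + 9 * (P.G * P.L) := by rw [hZ]; ring
    rw [e] at h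
    linarith only [h, hGL]
  -- (b) kpts·t·log p/(p−1) ≤ kpts·t ≤ 2ⁿ·Z/2 + Z/128
  have hlpp : Real.log P.p / ((P.p : ℝ) - 1) ≤ 1 := by
    rw [div_le_one (by linarith only [hp2])]
    have := Real.log_le_sub_one_of_pos (show (0:ℝ) < P.p by linarith only [hp2])
    linarith only [this]
  have hB : (kpts : ℝ) * ((P.T s : ℝ) + 1) * (Real.log P.p / ((P.p : ℝ) - 1)) ≤ 2 ^ n * Z / 2 + Z / 128 := by
    have e1 : (kpts : ℝ) * ((P.T s : ℝ) + 1) * (Real.log P.p / ((P.p : ℝ) - 1)) ≤ (kpts : ℝ) * ((P.T s : ℝ) + 1) := by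
      have := mul_le_mul_of_nonneg_left hlpp hkt0; linarith only [this]
    have e2 := mul_le_mul_of_nonneg_left hXL h2n0
    linarith only [e1, e2, hkt, hLZ]
  -- (c) t·log(2 kpts) ≤ Z/4
  have hC : ((P.T s : ℝ) + 1) * Real.log (2 * kpts) ≤ (25 / 100) * Z := by
    have hk0 : (0 : ℝ) < kpts := by exact_mod_cast hk1
    have h2k : (0 : ℝ) < 2 * (kpts : ℝ) := by linarith only [hk0]
    have hle : 2 * (kpts : ℝ) ≤ 2 * (2 ^ (ν + 1) * (P.Xs s : ℝ) + 1) := by linarith only [hk]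
    have hmono : Real.log (2 * (kpts : ℝ)) ≤ Real.log (2 * (2 ^ (ν + 1) * (P.Xs s : ℝ) + 1)) :=
      Real.log_le_log h2k hle
    calc ((P.T s : ℝ) + 1) * Real.log (2 * kpts) ≤ ((P.T s : ℝ) + 1) * Real.log (2 * (2 ^ (ν + 1) * (P.Xs s : ℝ) + 1)) :=
          mul_le_mul_of_nonneg_left hmono hT0
      _ ≤ (25 / 100) * Z := by rw [hZ]; exact hAc
  -- (d) (t/2 + 1)·log p ≤ (4L + 3/2)·(2G/3) ≤ Z/24 + Z/1152
  have hD : (((P.T s : ℝ) + 1) / 2 + 1) * Real.log P.p ≤ Z / 24 + Z / 1152 := by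
    have e1 : ((P.T s : ℝ) + 1) / 2 + 1 ≤ 4 * P.L + 3 / 2 := by linarith only [hT]
    have e2 : (((P.T s : ℝ) + 1) / 2 + 1) * Real.log P.p ≤ (4 * P.L + 3 / 2) * Real.log P.p := mul_le_mul_of_nonneg_right e1 hlp.le
    have hl23 : Real.log P.p ≤ (2 / 3) * P.G := by linarith only [hGlog]
    have h4L : (0 : ℝ) ≤ 4 * P.L + 3 / 2 := by linarith only [hL]
    have e3 : (4 * P.L + 3 / 2) * Real.log P.p ≤ (4 * P.L + 3 / 2) * ((2 / 3) * P.G) :=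
      mul_le_mul_of_nonneg_left hl23 h4L
    have e4 : (4 * (P.L : ℝ) + 3 / 2) * ((2 / 3) * P.G) = (8 / 3) * (P.G * P.L) + P.G := by ring
    linarith only [e2, e3, e4, hGL, hGZ, hZ0]
  -- sum
  rw [hGdef]
  push_cast
  have e5 : (kpts : ℝ) * ((P.T s : ℝ) + 1) * (Real.log P.p / ((P.p : ℝ) - 1)) =
      (kpts : ℝ) * ((P.T s : ℝ) + 1) * (Real.log P.p / ((P.p : ℝ) - 1)) := rfl
  linarith only [hA, hB, hC, hD, hZ2, hZ0]

end PadicG3Par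

/-! ### The four exponent hypotheses of `ineqPackR₃_of_lines` at `Sc := P.sched1b b` -/

namespace G3Setup

variable {p : ℕ} [Fact p.Prime] (S : G3Setup p) (P : PadicG3Par S.n) (b : ℝ)

/-- One family's exponent at the v1 schedule: nodes `kpts` with `1 ≤ kpts ≤ 2^{ν+1}·Xs s + 1` (`ν ≤ n`), jets `t = T s + 1`.
[cite: Nesterenko2003, §4.2; shape only] -/
theorem famExp_sched1_le (hPp : P.p = p) (hm : 1 ≤ P.m) (hθ : P.θ₀ = 1 / 2) {E : ℕ} (hE : 11 * 2 ^ S.n * (P.G * P.X * P.L) ≤ (E : ℝ) * Real.log P.p)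
    (s : ℕ) {ν : ℕ} (hν : ν ≤ S.n) {kpts : ℕ} (hk1 : 1 ≤ kpts) (hk : (kpts : ℝ) ≤ 2 ^ (ν + 1) * (P.Xs s : ℝ) + 1) :
    (P.T s + 1 - 1) / 2 + condExp p kpts (P.T s + 1) + P.m * (kpts * (P.T s + 1)) + (kpts * (P.T s + 1) + 1) / 2 ≤ E := by
  have hp2 : 2 ≤ p := (Fact.out : p.Prime).two_le
  have h := P.expCore_sched1 hm hθ s hν hk1 hk
  rw [hPp] at h hE
  exact PadicG3Par.famExp_le_of_real hp2 (h.trans hE)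

/-- **`hexpK0` at `sched1b b`.** [cite: Nesterenko2003, §4.2; shape only] -/
theorem hexpK0_sched1b (hPp : P.p = p) (hm : 1 ≤ P.m) (hθ : P.θ₀ = 1 / 2) {E : ℕ}
    (hE : 11 * 2 ^ S.n * (P.G * P.X * P.L) ≤ (E : ℝ) * Real.log P.p) :
    ∀ ν < S.n, (S.tS (P.sched1b b) 0 - 1) / 2 + condExp p (2 * S.NS (P.sched1b b) 0 ν + 1) (S.tS (P.sched1b b) 0) +
      (P.sched1b b).m * ((2 * S.NS (P.sched1b b) 0 ν + 1) * S.tS (P.sched1b b) 0) +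
      ((2 * S.NS (P.sched1b b) 0 ν + 1) * S.tS (P.sched1b b) 0 + 1) / 2 ≤ E := by
  intro ν hν
  refine S.famExp_sched1_le P hPp hm hθ hE 0 hν.le (by omega) ?_
  show ((2 * (2 ^ ν * P.Xs 0) + 1 : ℕ) : ℝ) ≤ 2 ^ (ν + 1) * (P.Xs 0 : ℝ) + 1
  push_cast; rw [pow_succ]; ring_nf; rfl

/-- **`hexpH` at `sched1b b`.** [cite: Nesterenko2003, §4.3; shape only] -/
theorem hexpH_sched1b (hPp : P.p = p) (hm : 1 ≤ P.m) (hθ : P.θ₀ = 1 / 2) {E : ℕ}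
    (hE : 11 * 2 ^ S.n * (P.G * P.X * P.L) ≤ (E : ℝ) * Real.log P.p) :
    ∀ lev < (P.sched1b b).Sd, (S.tS (P.sched1b b) lev - 1) / 2 + condExp p (2 * S.NS (P.sched1b b) lev S.n + 1) (S.tS (P.sched1b b) lev) +
      (P.sched1b b).m * ((2 * S.NS (P.sched1b b) lev S.n + 1) * S.tS (P.sched1b b) lev) +
      ((2 * S.NS (P.sched1b b) lev S.n + 1) * S.tS (P.sched1b b) lev + 1) / 2 ≤ E := by
  intro lev _
  refine S.famExp_sched1_le P hPp hm hθ hE lev le_rfl (by omega) ?_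
  show ((2 * (2 ^ S.n * P.Xs lev) + 1 : ℕ) : ℝ) ≤ 2 ^ (S.n + 1) * (P.Xs lev : ℝ) + 1
  push_cast; rw [pow_succ]; ring_nf; rfl

/-- **`hexpO` at `sched1b b`.** [cite: Nesterenko2003, §4.2; shape only] -/
theorem hexpO_sched1b (hPp : P.p = p) (hm : 1 ≤ P.m) (hθ : P.θ₀ = 1 / 2) {E : ℕ}
    (hE : 11 * 2 ^ S.n * (P.G * P.X * P.L) ≤ (E : ℝ) * Real.log P.p) :
    ∀ lev < (P.sched1b b).Sd, (S.tS (P.sched1b b) (lev + 1) - 1) / 2 + condExp p (2 * S.NhS (P.sched1b b) (lev + 1)) (S.tS (P.sched1b b) (lev + 1)) +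
      (P.sched1b b).m * ((2 * S.NhS (P.sched1b b) (lev + 1)) * S.tS (P.sched1b b) (lev + 1)) +
      ((2 * S.NhS (P.sched1b b) (lev + 1)) * S.tS (P.sched1b b) (lev + 1) + 1) / 2 ≤ E := by
  intro lev _
  have h1 := P.one_le_Xs (lev + 1)
  refine S.famExp_sched1_le P hPp hm hθ hE (lev + 1) (Nat.zero_le S.n) (by show 1 ≤ 2 * P.Xs (lev + 1); omega) ?_
  show ((2 * P.Xs (lev + 1) : ℕ) : ℝ) ≤ 2 ^ (0 + 1) * (P.Xs (lev + 1) : ℝ) + 1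
  push_cast; linarith

/-- **`hexpK` at `sched1b b`.** [cite: Nesterenko2003, §4.2; shape only] -/
theorem hexpK_sched1b (hPp : P.p = p) (hm : 1 ≤ P.m) (hθ : P.θ₀ = 1 / 2) {E : ℕ}
    (hE : 11 * 2 ^ S.n * (P.G * P.X * P.L) ≤ (E : ℝ) * Real.log P.p) :
    ∀ lev < (P.sched1b b).Sd, ∀ ν, 1 ≤ ν → ν < S.n →
      (S.tS (P.sched1b b) (lev + 1) - 1) / 2 + condExp p (2 * S.NS (P.sched1b b) (lev + 1) ν + 1) (S.tS (P.sched1b b) (lev + 1)) +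
      (P.sched1b b).m * ((2 * S.NS (P.sched1b b) (lev + 1) ν + 1) * S.tS (P.sched1b b) (lev + 1)) +
      ((2 * S.NS (P.sched1b b) (lev + 1) ν + 1) * S.tS (P.sched1b b) (lev + 1) + 1) / 2 ≤ E := by
  intro lev _ ν _ hν
  refine S.famExp_sched1_le P hPp hm hθ hE (lev + 1) hν.le (by omega) ?_
  show ((2 * (2 ^ ν * P.Xs (lev + 1)) + 1 : ℕ) : ℝ) ≤ 2 ^ (ν + 1) * (P.Xs (lev + 1) : ℝ) + 1
  push_cast; rw [pow_succ]; ring_nf; rfl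

end G3Setup

end Summit.ABC.StewartYu

end
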